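import Literature.MathematicalPhysics.QuantumManyBody.TruncatedFockSpace
import Literature.MathematicalPhysics.QuantumManyBody.TorusFockSectorDictionary
import HarnessLib

/-!
# The `N`-boson sector of `ℓ²` of words and its occupation-number Hilbert basis

Topic `Literature/MathematicalPhysics/QuantumManyBody`, namespace `BoseGas.Fock`; sequel of
`TruncatedFockSpace.lean` (the Fock space `ℓ²(ι →₀ ℕ)` in the occupation basis) and of
`TorusFockSectorDictionary.lean` (`Fock.wordOcc k = ∑ᵢ e_{kᵢ}`, the occupation configuration of a word
`k : Fin N → ι`). Written for the provefact
`Literature.MathematicalPhysics.QuantumManyBody.BoseGas.BoccatoEtAl2019Acta_firstExcitation`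
([BoccatoEtAl2019Acta]): the unitary `U_N : L²_s(Λ^N) → 𝓕_+^{≤N}` of [ibid., §1 (eq. (1.x)), §2] that
factors out the condensate is, in momentum space, the composition of
(1) the momentum (Fourier) representation `L²(Λ^N) ≅ ℓ²((Λ*)^N)` (words of momenta; Mathlib's
`UnitAddTorus.mFourierBasis`, cf. `PeriodicConfigFourier.lean`), (2) **the occupation-number
representation of the Bose-symmetric sector** `ℓ²_s((Λ*)^N) ≅ ℓ²({d : Λ* →₀ ℕ, |d| = N})` — THIS FILE —
and (3) dropping the zero-mode occupation `d ↦ (d|_{Λ*₊}, N - d₀)`, a bijection onto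
`{d₊ : |d₊| ≤ N}`, i.e. onto the basis of `𝓕_+^{≤N} = truncFock Λ*₊ N` (`ExcitationMap.lean`).

For a type of modes `ι` and `N : ℕ`:
* `WordSpace ι N = ℓ²(Fin N → ι)` and its **bosonic sector** `bosonicSector ι N`, the closed
  subspace of amplitudes that depend on the word only through its occupation configuration
  (`mem_bosonicSector_iff_comp_perm`: equivalently, invariant under permutations of the particles —
  two words with the same configuration differ by a permutation, `exists_perm_of_wordOcc_eq`);
* the fibre `wordFibre d` of a configuration (the finitely many words `k` with `wordOcc k = d`; non-empty
  iff `|d| = N`, `wordFibre_nonempty`), and the **occupation-number basis vector**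
  `sectorBasisVec d = (#fibre)^{-1/2} ∑_{k : wordOcc k = d} δ_k` — the symmetrised normalised product
  state `|d⟩ = (N!/d!)^{-1/2} ∑_{k} φ_{k₁} ⊗ ⋯ ⊗ φ_{k_N}` of [LSSY2005, App. A (A.9)];
* `orthonormal_sectorBasisVec`, and completeness in the sector (`eq_zero_of_forall_inner_sectorBasisVec`);
* the Hilbert basis `sectorBasis ι N` of `bosonicSector ι N` indexed by `{d // d.degree = N}` and the
  **occupation-number representation** `sectorRepr ι N : bosonicSector ι N ≃ₗᵢ[ℂ] ℓ²({d // d.degree = N})`,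
  with `sectorRepr_apply` (`(sectorRepr c)(d) = √(#fibre) · c(k)` for any word `k` of configuration `d`).

## References
* [BoccatoEtAl2019Acta] Boccato–Brennecke–Cenatiempo–Schlein, Acta Math. 222 (2019), §2 (`U_N`, `𝓕_+^{≤N}`).
* [LSSY2005] Lieb–Seiringer–Solovej–Yngvason (2005), App. A (A.9)–(A.11) (occupation-number states).
-/

noncomputable section

open Filter Set Function Finset
open scoped ENNReal NNReal ComplexConjugate InnerProductSpace BigOperators

namespace Literature.MathematicalPhysics.QuantumManyBody.BoseGas.Fock

variable {ι : Type*} [DecidableEq ι] {N : ℕ}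

/-! ### Words, configurations and fibres -/

/-- **The space of amplitudes of `N` distinguishable particles over the modes `ι`**: `ℓ²(Fin N → ι)`
(in momentum space, `L²(Λ^N)` in the plane-wave basis). [folklore] -/
abbrev WordSpace (ι : Type*) (N : ℕ) : Type _ := lp (fun _ : (Fin N → ι) => ℂ) 2

/-- The letter count of a word: `(wordOcc k) m = #{i : k i = m}`. [folklore] -/
theorem wordOcc_apply (k : Fin N → ι) (m : ι) : wordOcc k m = #{i | k i = m} := by
  unfold wordOcc
  rw [Finsupp.coe_finsetSum, Finset.sum_apply, Finset.card_filter]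
  refine Finset.sum_congr rfl fun i _ => ?_
  rw [Finsupp.single_apply]

/-- **Two words with the same occupation configuration differ by a permutation of the particles.**
[folklore] -/
theorem exists_perm_of_wordOcc_eq {k k' : Fin N → ι} (h : wordOcc k = wordOcc k') :
    ∃ σ : Equiv.Perm (Fin N), k' = k ∘ σ := by
  classical
  have hcard : ∀ m : ι, Fintype.card {i // k' i = m} = Fintype.card {i // k i = m} := fun m => by
    rw [Fintype.card_subtype, Fintype.card_subtype, ← wordOcc_apply, ← wordOcc_apply, h]
  let e : ∀ m : ι, {i // k' i = m} ≃ {i // k i = m} := fun m => Fintype.equivOfCardEq (hcard m)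
  refine ⟨Equiv.ofFiberEquiv e, funext fun i => ?_⟩
  exact (Equiv.ofFiberEquiv_map e i).symm

/-- The letters of a word lie in the support of its configuration. [folklore] -/
theorem mem_support_wordOcc (k : Fin N → ι) (i : Fin N) : k i ∈ (wordOcc k).support := by
  rw [Finsupp.mem_support_iff, wordOcc_apply]
  exact Finset.card_ne_zero.2 ⟨i, by simp⟩

/-- **The fibre of a configuration**: the (finitely many) words `k` with `wordOcc k = d`. [folklore] -/
def wordFibre (N : ℕ) (d : ι →₀ ℕ) : Finset (Fin N → ι) :=
  (Fintype.piFinset fun _ : Fin N => d.support).filter fun k => wordOcc k = d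

/-- Membership in the fibre. [folklore] -/
theorem mem_wordFibre {d : ι →₀ ℕ} {k : Fin N → ι} : k ∈ wordFibre N d ↔ wordOcc k = d := by
  unfold wordFibre
  rw [Finset.mem_filter, Fintype.mem_piFinset]
  constructor
  · exact fun h => h.2
  · intro h
    exact ⟨fun i => h ▸ mem_support_wordOcc k i, h⟩

/-- A word lies in the fibre of its own configuration. [folklore] -/
theorem mem_wordFibre_self (k : Fin N → ι) : k ∈ wordFibre N (wordOcc k) := mem_wordFibre.2 rfl

omit [DecidableEq ι] in
/-- **Every configuration of degree `N` is the configuration of some word of length `N`.** [folklore] -/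
theorem exists_wordOcc_eq : ∀ {N : ℕ} (d : ι →₀ ℕ), d.degree = N → ∃ k : Fin N → ι, wordOcc k = d
  | 0, d, hd => ⟨Fin.elim0, by
      rw [wordOcc_zero]; exact ((Finsupp.degree_eq_zero_iff d).1 hd).symm⟩
  | N + 1, d, hd => by
      have hd0 : d ≠ 0 := fun h => by rw [h, map_zero] at hd; exact Nat.succ_ne_zero N hd.symm
      obtain ⟨m, hm⟩ := Finsupp.support_nonempty_iff.2 hd0
      have hm1 : 1 ≤ d m := Nat.one_le_iff_ne_zero.2 (Finsupp.mem_support_iff.1 hm)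
      have hdeg : (d - Finsupp.single m 1).degree = N := by
        rw [degree_tsub_single hm1, hd]; rfl
      obtain ⟨k, hk⟩ := exists_wordOcc_eq (d - Finsupp.single m 1) hdeg
      refine ⟨Fin.cons m k, ?_⟩
      rw [wordOcc_cons, hk, add_comm, tsub_single_add_single hm1]

/-- The fibre of a configuration of degree `N` is non-empty. [folklore] -/
theorem wordFibre_nonempty {d : ι →₀ ℕ} (hd : d.degree = N) : (wordFibre N d).Nonempty := by
  obtain ⟨k, hk⟩ := exists_wordOcc_eq d hd
  exact ⟨k, mem_wordFibre.2 hk⟩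

/-- Words of length `N` have configurations of degree `N`: the fibre is empty otherwise. [folklore] -/
theorem wordFibre_eq_empty {d : ι →₀ ℕ} (hd : d.degree ≠ N) : wordFibre N d = ∅ := by
  refine Finset.eq_empty_of_forall_notMem fun k hk => hd ?_
  rw [← mem_wordFibre.1 hk, degree_wordOcc]

/-! ### The bosonic sector -/

/-- **The `N`-boson sector** of `ℓ²(Fin N → ι)`: the amplitudes that depend on the word only through
its occupation configuration (equivalently, `mem_bosonicSector_iff_comp_perm`, that are invariant
under permutations of the particles — Bose symmetry in momentum space).
[cite: BoccatoEtAl2019Acta, §2 (`L²_s(Λ^N)`)] -/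
def bosonicSector (ι : Type*) [DecidableEq ι] (N : ℕ) : Submodule ℂ (WordSpace ι N) where
  carrier := {c | ∀ k k' : Fin N → ι, wordOcc k = wordOcc k' → c k = c k'}
  zero_mem' := fun _ _ _ => rfl
  add_mem' := by
    intro c c' hc hc' k k' h
    rw [lp.coeFn_add, Pi.add_apply, Pi.add_apply, hc k k' h, hc' k k' h]
  smul_mem' := by
    intro a c hc k k' h
    rw [lp.coeFn_smul, Pi.smul_apply, Pi.smul_apply, hc k k' h]

/-- Membership in the bosonic sector. [folklore] -/
theorem mem_bosonicSector {c : WordSpace ι N} :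
    c ∈ bosonicSector ι N ↔ ∀ k k' : Fin N → ι, wordOcc k = wordOcc k' → c k = c k' := Iff.rfl

/-- **Bose symmetry**: an amplitude lies in the bosonic sector iff it is invariant under permutations
of the particles. [cite: BoccatoEtAl2019Acta, §2 (`L²_s(Λ^N)`)] -/
theorem mem_bosonicSector_iff_comp_perm {c : WordSpace ι N} :
    c ∈ bosonicSector ι N ↔ ∀ (σ : Equiv.Perm (Fin N)) (k : Fin N → ι), c (k ∘ σ) = c k := by
  constructor
  · intro hc σ k
    exact hc _ _ (wordOcc_comp_perm k σ)
  · intro h k k' hkk'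
    obtain ⟨σ, rfl⟩ := exists_perm_of_wordOcc_eq hkk'
    exact (h σ k).symm

/-- The amplitude functional `c ↦ c(k)` on `ℓ²` of words (bounded by `1`). [folklore] -/
def wordCoord (k : Fin N → ι) : WordSpace ι N →L[ℂ] ℂ :=
  LinearMap.mkContinuous
    { toFun := fun c => c k
      map_add' := fun c c' => by rw [lp.coeFn_add, Pi.add_apply]
      map_smul' := fun a c => by rw [lp.coeFn_smul, Pi.smul_apply, RingHom.id_apply] }
    1 fun c => by simpa using lp.norm_apply_le_norm two_ne_zero c k

omit [DecidableEq ι] in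
/-- The amplitude functional `c ↦ c(k)` is continuous on `ℓ²`. [folklore] -/
theorem continuous_apply_wordSpace (k : Fin N → ι) : Continuous fun c : WordSpace ι N => c k :=
  (wordCoord k).continuous

/-- The bosonic sector is closed. [folklore] -/
theorem isClosed_bosonicSector (ι : Type*) [DecidableEq ι] (N : ℕ) :
    IsClosed (bosonicSector ι N : Set (WordSpace ι N)) := by
  have : (bosonicSector ι N : Set (WordSpace ι N)) =
      ⋂ p ∈ {p : (Fin N → ι) × (Fin N → ι) | wordOcc p.1 = wordOcc p.2}, {c | c p.1 = c p.2} := by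
    ext c
    simp only [SetLike.mem_coe, mem_bosonicSector, mem_iInter, mem_setOf_eq, Prod.forall]
  rw [this]
  exact isClosed_biInter fun p _ =>
    isClosed_eq (continuous_apply_wordSpace p.1) (continuous_apply_wordSpace p.2)

/-- The bosonic sector is complete (a Hilbert space). [folklore] -/
instance instCompleteSpaceBosonicSector (ι : Type*) [DecidableEq ι] (N : ℕ) :
    CompleteSpace (bosonicSector ι N) :=
  (isClosed_bosonicSector ι N).completeSpace_coe

/-! ### The occupation-number basis vectors of the sector -/

/-- The sum of the word basis vectors over a fibre, `∑_{k : wordOcc k = d} δ_k`. [folklore] -/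
def fibreSum (N : ℕ) (d : ι →₀ ℕ) : WordSpace ι N := ∑ k ∈ wordFibre N d, lp.single 2 k (1 : ℂ)

/-- The amplitudes of the fibre sum: the indicator of the fibre. [folklore] -/
theorem fibreSum_apply (d : ι →₀ ℕ) (k : Fin N → ι) :
    fibreSum N d k = if wordOcc k = d then 1 else 0 := by
  unfold fibreSum
  rw [lp.coeFn_sum, Finset.sum_apply]
  simp_rw [lp.single_apply, Pi.single_apply]
  rw [Finset.sum_ite_eq]
  simp only [mem_wordFibre]

/-- **The occupation-number basis vector of the `N`-boson sector**:
`|d⟩ = (#fibre)^{-1/2} ∑_{k : wordOcc k = d} δ_k`, the symmetrised normalised product state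
`(N!/d!)^{-1/2} ∑ φ_{k₁} ⊗ ⋯ ⊗ φ_{k_N}`. [cite: LSSY2005, App. A (A.9)] -/
def sectorBasisVec (N : ℕ) (d : ι →₀ ℕ) : WordSpace ι N :=
  (((Real.sqrt (wordFibre N d).card)⁻¹ : ℝ) : ℂ) • fibreSum N d

/-- The amplitudes of `|d⟩`. [folklore] -/
theorem sectorBasisVec_apply (d : ι →₀ ℕ) (k : Fin N → ι) :
    sectorBasisVec N d k = if wordOcc k = d then (((Real.sqrt (wordFibre N d).card)⁻¹ : ℝ) : ℂ) else 0 := by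
  rw [sectorBasisVec, lp.coeFn_smul, Pi.smul_apply, fibreSum_apply, smul_eq_mul]
  split_ifs <;> simp

/-- `|d⟩` lies in the bosonic sector. [folklore] -/
theorem sectorBasisVec_mem (d : ι →₀ ℕ) : sectorBasisVec N d ∈ bosonicSector ι N := fun k k' h => by
  rw [sectorBasisVec_apply, sectorBasisVec_apply, h]

/-- `⟨fibreSum d, c⟩ = ∑_{k ∈ fibre} c(k)`. [folklore] -/
theorem inner_fibreSum_left (d : ι →₀ ℕ) (c : WordSpace ι N) :
    ⟪fibreSum N d, c⟫_ℂ = ∑ k ∈ wordFibre N d, c k := by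
  unfold fibreSum
  rw [sum_inner]
  refine Finset.sum_congr rfl fun k _ => ?_
  rw [lp.inner_single_left]
  simp

/-- `⟨d|c⟩ = (#fibre)^{-1/2} ∑_{k ∈ fibre} c(k)`. [folklore] -/
theorem inner_sectorBasisVec_left (d : ι →₀ ℕ) (c : WordSpace ι N) :
    ⟪sectorBasisVec N d, c⟫_ℂ = (((Real.sqrt (wordFibre N d).card)⁻¹ : ℝ) : ℂ) * ∑ k ∈ wordFibre N d, c k := by
  rw [sectorBasisVec, inner_smul_left, Complex.conj_ofReal, inner_fibreSum_left]

/-- For a symmetric amplitude the fibre sum is `#fibre · c(k)` for any word `k` of the fibre. [folklore] -/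
theorem sum_wordFibre_eq_card_mul {c : WordSpace ι N} (hc : c ∈ bosonicSector ι N) {d : ι →₀ ℕ}
    {k : Fin N → ι} (hk : wordOcc k = d) : ∑ k' ∈ wordFibre N d, c k' = (wordFibre N d).card * c k := by
  rw [Finset.sum_congr rfl fun k' hk' => hc k' k ((mem_wordFibre.1 hk').trans hk.symm), Finset.sum_const,
    nsmul_eq_mul]

/-- **`⟨d|c⟩ = √(#fibre) · c(k)` for a symmetric amplitude `c` and any word `k` of configuration `d`.**
[folklore] -/
theorem inner_sectorBasisVec_left_of_mem {c : WordSpace ι N} (hc : c ∈ bosonicSector ι N) {d : ι →₀ ℕ}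
    {k : Fin N → ι} (hk : wordOcc k = d) :
    ⟪sectorBasisVec N d, c⟫_ℂ = ((Real.sqrt (wordFibre N d).card : ℝ) : ℂ) * c k := by
  rw [inner_sectorBasisVec_left, sum_wordFibre_eq_card_mul hc hk, ← mul_assoc]
  congr 1
  have hpos : (0 : ℝ) < (wordFibre N d).card := by
    exact_mod_cast Finset.card_pos.2 ⟨k, mem_wordFibre.2 hk⟩
  have : ((wordFibre N d).card : ℂ) = (((Real.sqrt (wordFibre N d).card * Real.sqrt (wordFibre N d).card : ℝ)) : ℂ) := by
    rw [Real.mul_self_sqrt hpos.le]; norm_cast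
  rw [this]
  push_cast
  rw [← mul_assoc, inv_mul_cancel₀ (by exact_mod_cast (Real.sqrt_pos.2 hpos).ne'), one_mul]

/-- **The occupation-number vectors are orthonormal** (over the configurations of degree `N`). [folklore] -/
theorem orthonormal_sectorBasisVec :
    Orthonormal ℂ (fun d : {d : ι →₀ ℕ // d.degree = N} => sectorBasisVec N (d : ι →₀ ℕ)) := by
  rw [orthonormal_iff_ite]
  rintro ⟨d, hd⟩ ⟨e, he⟩
  obtain ⟨k, hk⟩ := exists_wordOcc_eq d hd
  show ⟪sectorBasisVec N d, sectorBasisVec N e⟫_ℂ = _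
  rw [inner_sectorBasisVec_left_of_mem (sectorBasisVec_mem e) hk, sectorBasisVec_apply, hk]
  by_cases hde : d = e
  · subst hde
    rw [if_pos rfl, if_pos rfl]
    have hpos : (0 : ℝ) < (wordFibre N d).card := by exact_mod_cast Finset.card_pos.2 ⟨k, mem_wordFibre.2 hk⟩
    rw [← Complex.ofReal_mul, mul_inv_cancel₀ (Real.sqrt_pos.2 hpos).ne', Complex.ofReal_one]
  · rw [if_neg hde, mul_zero, if_neg]
    exact fun h => hde (Subtype.ext_iff.1 h)

/-- **Completeness in the sector**: a symmetric amplitude orthogonal to all `|d⟩`, `|d| = N`, vanishes.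
[folklore] -/
theorem eq_zero_of_forall_inner_sectorBasisVec {c : WordSpace ι N} (hc : c ∈ bosonicSector ι N)
    (h : ∀ d : ι →₀ ℕ, d.degree = N → ⟪sectorBasisVec N d, c⟫_ℂ = 0) : c = 0 := by
  refine lp.ext (funext fun k => ?_)
  have hk := h (wordOcc k) (degree_wordOcc k)
  rw [inner_sectorBasisVec_left_of_mem hc rfl] at hk
  have hpos : (0 : ℝ) < (wordFibre N (wordOcc k)).card := by
    exact_mod_cast Finset.card_pos.2 ⟨k, mem_wordFibre_self k⟩
  rcases mul_eq_zero.1 hk with h0 | h0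
  · exact absurd (by exact_mod_cast h0 : Real.sqrt (wordFibre N (wordOcc k)).card = 0) (Real.sqrt_pos.2 hpos).ne'
  · rw [h0]; rfl

/-! ### The Hilbert basis of the sector and the occupation-number representation -/

/-- The basis vectors as elements of the sector. [folklore] -/
def sectorBasisVec' (ι : Type*) [DecidableEq ι] (N : ℕ) (d : {d : ι →₀ ℕ // d.degree = N}) : bosonicSector ι N :=
  ⟨sectorBasisVec N (d : ι →₀ ℕ), sectorBasisVec_mem _⟩

/-- Orthonormality inside the sector. [folklore] -/
theorem orthonormal_sectorBasisVec' : Orthonormal ℂ (sectorBasisVec' ι N) := by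
  rw [orthonormal_iff_ite]
  intro d e
  have h := orthonormal_iff_ite.1 (orthonormal_sectorBasisVec (ι := ι) (N := N)) d e
  rw [← h]
  rfl

/-- The span of the basis vectors has trivial orthogonal complement in the sector. [folklore] -/
theorem span_sectorBasisVec'_orthogonal_eq_bot :
    (Submodule.span ℂ (Set.range (sectorBasisVec' ι N)))ᗮ = ⊥ := by
  rw [Submodule.eq_bot_iff]
  intro x hx
  rw [Submodule.mem_orthogonal] at hx
  have hx0 : (x : WordSpace ι N) = 0 := by
    refine eq_zero_of_forall_inner_sectorBasisVec x.2 fun d hd => ?_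
    have := hx (sectorBasisVec' ι N ⟨d, hd⟩) (Submodule.subset_span ⟨⟨d, hd⟩, rfl⟩)
    exact this
  exact Subtype.ext hx0

/-- **The occupation-number Hilbert basis of the `N`-boson sector**, indexed by the configurations of
degree `N`. [cite: LSSY2005, App. A (A.9)–(A.11)] -/
def sectorBasis (ι : Type*) [DecidableEq ι] (N : ℕ) :
    HilbertBasis {d : ι →₀ ℕ // d.degree = N} ℂ (bosonicSector ι N) :=
  HilbertBasis.mkOfOrthogonalEqBot orthonormal_sectorBasisVec' span_sectorBasisVec'_orthogonal_eq_bot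

/-- The vectors of the Hilbert basis are the `|d⟩`. [folklore] -/
theorem sectorBasis_apply (d : {d : ι →₀ ℕ // d.degree = N}) :
    (sectorBasis ι N d : WordSpace ι N) = sectorBasisVec N (d : ι →₀ ℕ) := by
  rw [sectorBasis, HilbertBasis.coe_mkOfOrthogonalEqBot]
  rfl

/-- **The occupation-number representation of the `N`-boson sector**: the unitary
`ℓ²_s(Fin N → ι) ≃ ℓ²({d : ι →₀ ℕ // |d| = N})` (in momentum space: `L²_s(Λ^N)` ≅ the `N`-particle sector
of the bosonic Fock space in the occupation basis). [cite: BoccatoEtAl2019Acta, §2; LSSY2005, App. A (A.9)] -/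
def sectorRepr (ι : Type*) [DecidableEq ι] (N : ℕ) :
    bosonicSector ι N ≃ₗᵢ[ℂ] lp (fun _ : {d : ι →₀ ℕ // d.degree = N} => ℂ) 2 :=
  (sectorBasis ι N).repr

/-- The occupation amplitudes: `(sectorRepr c)(d) = ⟨d|c⟩`. [folklore] -/
theorem sectorRepr_apply_eq_inner (c : bosonicSector ι N) (d : {d : ι →₀ ℕ // d.degree = N}) :
    sectorRepr ι N c d = ⟪sectorBasisVec N (d : ι →₀ ℕ), (c : WordSpace ι N)⟫_ℂ := by
  rw [sectorRepr, HilbertBasis.repr_apply_apply]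
  rw [← sectorBasis_apply]
  rfl

/-- **The occupation amplitudes of a symmetric state**: `(sectorRepr c)(d) = √(#fibre d) · c(k)` for any
word `k` of configuration `d` (the familiar `√(N!/d!)` between ordered and symmetric amplitudes,
cf. `Fock.amp`). [cite: LSSY2005, App. A (A.9)] -/
theorem sectorRepr_apply (c : bosonicSector ι N) {d : {d : ι →₀ ℕ // d.degree = N}} {k : Fin N → ι}
    (hk : wordOcc k = (d : ι →₀ ℕ)) :
    sectorRepr ι N c d = ((Real.sqrt (wordFibre N (d : ι →₀ ℕ)).card : ℝ) : ℂ) * (c : WordSpace ι N) k := by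
  rw [sectorRepr_apply_eq_inner, inner_sectorBasisVec_left_of_mem c.2 hk]

/-- The inverse: `sectorRepr⁻¹ δ_d = |d⟩`. [folklore] -/
theorem sectorRepr_symm_single (d : {d : ι →₀ ℕ // d.degree = N}) :
    ((sectorRepr ι N).symm (lp.single 2 d (1 : ℂ)) : WordSpace ι N) = sectorBasisVec N (d : ι →₀ ℕ) := by
  rw [sectorRepr, HilbertBasis.repr_symm_single, sectorBasis_apply]

end Literature.MathematicalPhysics.QuantumManyBody.BoseGas.Fock
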